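import Literature.NumberTheory.EllipticCurves.PeriodLatticePresentationProofs
import Literature.NumberTheory.EllipticCurves.ManinConstantGamma1ModularDegree
import Literature.NumberTheory.EllipticCurves.ModularCurve
import Literature.NumberTheory.EllipticCurves.CuspFormLFunction
import Literature.NumberTheory.EllipticCurves.ModularSymbolsLattice
import Literature.NumberTheory.EllipticCurves.RealLatticePeriod
import HarnessLib

/-!
# The Kummer form on the parity cover — analytic core (line `nsf` v20, stub S3-U `stub_kummerForm`, crux `StarOptBNSF`, stmt-BirchSwinnertonDyer-27047)

**Analytic core of stub S3-U** (the stub itself is `…KummerForm.stub_kummerForm`, next file).  Data: `W₁/ℚ` with newform `f ∈ S₂(Γ₀(N))`, a period pair `L₁ ⊇ c₁Λ₁(f)` (`c₁ ≠ 0`), a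
half-period `λ/2` with `℘_{L₁}(λ/2) − b₂/12 = x₁`, the parity group `Γ′ ≤ Γ₁(N)` (membership: `c₁{∞,γ∞}_f ∈ ℤλ + 2L₁`),
the Kummer function `g` of stub S3-K (analytic off `L₁`, `g² = ℘_{L₁} − ℘_{L₁}(λ/2)`, `g(w + ℓ) = ±g(w)` with `+` exactly on
`ℤλ + 2L₁`), and cusp forms `G₁, Φ₁ ∈ S_k(Γ₁(N))`, `G₁ ≠ 0`, `Φ₁ = x_{W₁}·G₁` off the poles of
`x_{W₁}(τ) = ℘_{L₁}(c₁u_f(τ)) − b₂/12`.  Claim: there is `h ∈ S_k(Γ′)`, `h ≠ 0`, ANTI-invariant under `Γ₁(N) ∖ Γ′`, with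
`h² = (Φ₁ − x₁G₁)·G₁ =: Ψ` on `ℍ`.

Proof (the «holomorphic square root of the cusp form `Ψ`»).  On the complex half-plane `H = {im > 0}` put
`U(w) = c₁u_f(w)`, `X = g ∘ U`, `Gc = G₁ ∘ ofComplex`; `X·Gc` is analytic off the pole set `P = {U ∈ L₁}` with
`(X·Gc)² = Ψ` there (§2).  The points of `P` are isolated (§1: `u_f` is nowhere locally constant, tree
`not_eventually_const_eichlerIntegral`), so at `z ∈ P` the function `X·Gc` is differentiable on a punctured neighbourhood
with bounded square, hence `(w − z)·(X·Gc) → 0`, hence `X·Gc` is meromorphic of non-negative order at `z` (§3, Riemann's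
removable singularity theorem `Complex.analyticAt_of_differentiable_on_punctured_nhds_of_continuousAt` and
`meromorphicOrderAt_mul`).  Its meromorphic normal form `Hc` is therefore analytic on `H` (tree `analyticAt_toMeromorphicNFOn`),
agrees with `X·Gc` off `P`, and by the identity theorem on the connected `H` (pattern of the tree's
`exists_invariant_extension`): `Hc² = Ψ`, and `Hc(γz) = ε(γ)·(cz + d)^k·Hc(z)` for `γ ∈ Γ₁(N)`, where
`u_f(γτ) = u_f(τ) + {∞,γ∞}_f` (tree `eichlerIntegral_smul_sub_holds`), `c₁{∞,γ∞}_f ∈ c₁Λ₁(f) ⊆ L₁` (tree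
`cuspSymbol_mem_periodLatticeGamma1`) and `ε(γ) = ±1` is the sign of `g` under that period (§4).  On `ℍ`, `h := Hc` is then
`Γ′`-invariant and `(Γ₁(N) ∖ Γ′)`-anti-invariant of weight `k`; at every cusp `‖h∣A‖² = ‖(Φ₁ − x₁G₁)∣A‖·‖G₁∣A‖ → 0`
(Mathlib `CuspFormClass.zero_at_infty_slash`); and `h ≠ 0`, for otherwise `Ψ ≡ 0`, so (`G₁ ≠ 0`, analytic factors on the
connected `H`) `x_{W₁} ≡ x₁` off the poles, forcing `u_f(τ) ∈ (2c₁)⁻¹L₁` for EVERY `τ` — a countable condition (tree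
`countable_setOf_eichlerIntegral_mem_lattice`) on the uncountable `ℍ` (§5).
Pure complex analysis plus `CuspForm` bookkeeping; nothing here reads `r_an`; BSD is not proved by this file.
-/

set_option linter.dupNamespace false
set_option autoImplicit false

noncomputable section

open Complex Filter Topology Set Function
open UpperHalfPlane hiding I
open scoped Real Topology Manifold MatrixGroups PeriodPair ModularForm
open ModularForm CongruenceSubgroup

open Literature.NumberTheory.EllipticCurves Literature.NumberTheory.EllipticCurves.ModularForms

namespace Summit.BirchSwinnertonDyer.BirchSwinnertonDyer.Theorems.DepletionAtTwo.KummerForm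

variable {N : ℕ} [NeZero N]

/-! ### §1 The poles of `x_{W₁}` are isolated -/

/-- For `f ≠ 0`, `c ≠ 0`, a period pair `L` and `z` in the half-plane: on a punctured neighbourhood of `z`,
`c·u_f(w) ∉ Λ(L)` (`u_f` is nowhere locally constant and `Λ` is discrete). [folklore] -/
theorem eventually_mul_eichlerIntegral_notMem (f : CuspForm (Gamma0 N) 2) (hf : f ≠ 0) (L : PeriodPair)
    {c : ℂ} (hc : c ≠ 0) {z : ℂ} (hz : 0 < z.im) :
    ∀ᶠ w in 𝓝[≠] z, c * eichlerIntegral f (ofComplex w) ∉ L.lattice := by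
  set U : ℂ → ℂ := fun w ↦ c * eichlerIntegral f (ofComplex w) with hU
  have hUa : AnalyticAt ℂ U z := analyticAt_const.mul (analyticAt_eichlerIntegral_comp_ofComplex f hz)
  -- near `z`, `U w` avoids `Λ ∖ {U z}`
  have ha : ∀ᶠ w in 𝓝 z, U w ∈ ((L.lattice : Set ℂ) \ {U z})ᶜ :=
    hUa.continuousAt.preimage_mem_nhds (L.compl_lattice_sdiff_singleton_mem_nhds (U z))
  -- and `U w ≠ U z` on a punctured neighbourhood
  have hb : ∀ᶠ w in 𝓝[≠] z, U w ≠ U z := by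
    rcases (hUa.sub (analyticAt_const (v := U z))).eventually_eq_zero_or_eventually_ne_zero with h | h
    · exfalso
      apply not_eventually_const_eichlerIntegral f hf hz (eichlerIntegral f (ofComplex z))
      filter_upwards [h] with w hw
      have hw' : U w - U z = 0 := hw
      exact mul_left_cancel₀ hc (sub_eq_zero.mp hw')
    · exact h.mono fun w hw ↦ sub_ne_zero.mp hw
  filter_upwards [hb, mem_nhdsWithin_of_mem_nhds ha] with w hw1 hw2
  exact fun hmem ↦ hw2 ⟨hmem, hw1⟩

/-! ### §2 A meromorphic square root with analytic square has non-negative order -/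

/-- If `F` is differentiable on a punctured neighbourhood of `z` and `F² = Ψ` there, with `Ψ` analytic at `z`, then `F` is
meromorphic at `z` of non-negative order (`(w − z)F(w) → 0` by `‖F‖ = √‖Ψ‖`; Riemann's removable singularity theorem;
`2·ord F = ord Ψ ≥ 0`). [folklore] -/
theorem meromorphicAt_of_sq_eq {F Ψ : ℂ → ℂ} {z : ℂ} (hΨ : AnalyticAt ℂ Ψ z)
    (hF : ∀ᶠ w in 𝓝[≠] z, DifferentiableAt ℂ F w ∧ F w ^ 2 = Ψ w) :
    MeromorphicAt F z ∧ 0 ≤ meromorphicOrderAt F z := by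
  -- `(w - z) • F w → 0`
  set Φ : ℂ → ℂ := fun w ↦ (w - z) ^ 1 • F w with hΦ
  have hnorm : ∀ᶠ w in 𝓝[≠] z, ‖Φ w‖ ≤ ‖w - z‖ * Real.sqrt ‖Ψ w‖ := by
    filter_upwards [hF] with w hw
    have h1 : ‖F w‖ = Real.sqrt ‖Ψ w‖ := by
      rw [← Real.sqrt_sq (norm_nonneg (F w)), ← norm_pow, hw.2]
    simp only [hΦ, pow_one, smul_eq_mul, norm_mul, h1, le_refl]
  have hlim0 : Tendsto (fun w ↦ ‖w - z‖ * Real.sqrt ‖Ψ w‖) (𝓝[≠] z) (𝓝 0) := by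
    have h1 : Tendsto (fun w : ℂ ↦ ‖w - z‖) (𝓝 z) (𝓝 0) := tendsto_norm_sub_self z
    have h2 : Tendsto (fun w ↦ Real.sqrt ‖Ψ w‖) (𝓝 z) (𝓝 (Real.sqrt ‖Ψ z‖)) :=
      hΨ.continuousAt.norm.sqrt
    have := (h1.mul h2).mono_left (nhdsWithin_le_nhds (s := {z}ᶜ))
    simpa using this
  have hΦlim : Tendsto Φ (𝓝[≠] z) (𝓝 0) := squeeze_zero_norm' hnorm hlim0
  have hΦz : Φ z = 0 := by simp [hΦ]
  have hΦc : ContinuousAt Φ z := by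
    rw [← continuousWithinAt_compl_self, ContinuousWithinAt, hΦz]
    exact hΦlim
  have hΦd : ∀ᶠ w in 𝓝[≠] z, DifferentiableAt ℂ Φ w := by
    filter_upwards [hF] with w hw
    exact ((differentiableAt_id.sub_const z).pow 1).smul hw.1
  have hΦa : AnalyticAt ℂ Φ z := Complex.analyticAt_of_differentiable_on_punctured_nhds_of_continuousAt hΦd hΦc
  have hmer : MeromorphicAt F z := ⟨1, hΦa⟩
  refine ⟨hmer, ?_⟩
  -- `2·ord F = ord Ψ ≥ 0`
  have hcongr : (F * F) =ᶠ[𝓝[≠] z] Ψ := by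
    filter_upwards [hF] with w hw
    simp only [Pi.mul_apply, ← pow_two, hw.2]
  have hsum : 0 ≤ meromorphicOrderAt F z + meromorphicOrderAt F z := by
    rw [← meromorphicOrderAt_mul hmer hmer, meromorphicOrderAt_congr hcongr]
    exact hΨ.meromorphicOrderAt_nonneg
  cases ho : meromorphicOrderAt F z with
  | top => exact le_top
  | coe n =>
    rw [ho, ← WithTop.coe_add, WithTop.coe_nonneg] at hsum
    exact WithTop.coe_nonneg.mpr (by omega)

/-! ### §3 Cusp decay of a square root -/

/-- If `‖h τ‖² = ‖a τ‖·‖b τ‖` with `a, b → 0` at `i∞`, then `h → 0` at `i∞`. [folklore] -/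
theorem isZeroAtImInfty_of_norm_sq_eq {h a b : ℍ → ℂ} (hab : ∀ τ : ℍ, ‖h τ‖ ^ 2 = ‖a τ‖ * ‖b τ‖)
    (ha : IsZeroAtImInfty a) (hb : IsZeroAtImInfty b) : IsZeroAtImInfty h := by
  have h1 : ∀ τ : ℍ, ‖h τ‖ ≤ Real.sqrt (‖a τ‖ * ‖b τ‖) := fun τ ↦ by
    rw [← hab τ, Real.sqrt_sq (norm_nonneg _)]
  have h2 : Tendsto (fun τ : ℍ ↦ Real.sqrt (‖a τ‖ * ‖b τ‖)) atImInfty (𝓝 0) := by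
    have := (ha.norm.mul hb.norm).sqrt
    simpa using this
  exact squeeze_zero_norm' (Eventually.of_forall h1) h2

/-! ### §4 The analytic construction on the half-plane -/

/-- **The holomorphic square root of `Ψ = (Φ₁ − x₁G₁)·G₁` and its transformation law.**  With the data of stub S3-U
(see the file docstring) there is `H : ℍ → ℂ`, holomorphic, with `H(τ) = g(c₁u_f(τ))·G₁(τ)` off the poles,
`H² = (Φ₁ − x₁G₁)·G₁` everywhere, and `H∣[k]γ = ε·H` for every `γ ∈ Γ₁(N)` and every `ε` with
`g(w + c₁{∞,γ∞}_f) = ε·g(w)` off `L₁`. [cite: ShimuraIATAF1971, §2.4] [cite: SilvermanAEC2009, VI.3.6] [folklore] -/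
theorem exists_holomorphic_sqrt (W₁ : WeierstrassCurve ℚ)
    (f : CuspForm (Gamma0 N) 2) (hf : f ≠ 0) (L₁ : PeriodPair) (c₁ : ℚ) (hc₁ : c₁ ≠ 0)
    (hin : ∀ z ∈ periodLatticeGamma1 f, (c₁ : ℂ) * z ∈ L₁.lattice)
    (x₁ : ℚ) (lam : ℂ) (hwp : L₁.weierstrassP (lam / 2) - ((W₁.b₂ : ℚ) : ℂ) / 12 = ((x₁ : ℚ) : ℂ))
    (g : ℂ → ℂ)
    (hg1 : ∀ w : ℂ, w ∉ L₁.lattice → AnalyticAt ℂ g w ∧ g w ^ 2 = L₁.weierstrassP w - L₁.weierstrassP (lam / 2))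
    (k : ℤ) (G₁ Φ₁ : CuspForm (Gamma1 N) k)
    (hΦ : ∀ τ : ℍ, (c₁ : ℂ) * eichlerIntegral f τ ∉ L₁.lattice →
      Φ₁ τ = (L₁.weierstrassP ((c₁ : ℂ) * eichlerIntegral f τ) - ((W₁.b₂ : ℚ) : ℂ) / 12) * G₁ τ) :
    ∃ H : ℍ → ℂ, MDifferentiable 𝓘(ℂ) 𝓘(ℂ) H ∧
      (∀ τ : ℍ, (c₁ : ℂ) * eichlerIntegral f τ ∉ L₁.lattice →
        H τ = g ((c₁ : ℂ) * eichlerIntegral f τ) * G₁ τ) ∧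
      (∀ τ : ℍ, H τ ^ 2 = (Φ₁ τ - ((x₁ : ℚ) : ℂ) * G₁ τ) * G₁ τ) ∧
      (∀ (γ : SL(2, ℤ)) (hγ : γ ∈ Gamma1 N) (ε : ℂ),
        (∀ w : ℂ, w ∉ L₁.lattice →
          g (w + (c₁ : ℂ) * cuspSymbol f ⟨γ, Gamma1_in_Gamma0 N hγ⟩) = ε * g w) →
        H ∣[k] γ = ε • H) := by
  set Hset : Set ℂ := {z : ℂ | 0 < z.im} with hHset
  set U : ℂ → ℂ := fun w ↦ (c₁ : ℂ) * eichlerIntegral f (ofComplex w) with hU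
  set X : ℂ → ℂ := fun w ↦ g (U w) with hX
  set Gc : ℂ → ℂ := (⇑G₁) ∘ ofComplex with hGc
  set Ψc : ℂ → ℂ := fun w ↦ (Φ₁ (ofComplex w) - ((x₁ : ℚ) : ℂ) * G₁ (ofComplex w)) * G₁ (ofComplex w)
    with hΨc
  have hc₁' : (c₁ : ℂ) ≠ 0 := by exact_mod_cast hc₁
  -- the pole set through the auxiliary pair `L″ = c₁⁻¹L₁`
  have hc₁i : ((c₁ : ℂ)⁻¹) ≠ 0 := inv_ne_zero hc₁'
  set L'' : PeriodPair := L₁.mulLeft ((c₁ : ℂ)⁻¹) hc₁i with hL''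
  have hmemL'' : ∀ w : ℂ, U w ∈ L₁.lattice ↔ eichlerIntegral f (ofComplex w) ∈ L''.lattice := by
    intro w
    rw [hL'', PeriodPair.mem_mulLeft_lattice, inv_inv]
  -- analyticity of the ingredients
  have hUan : ∀ z ∈ Hset, AnalyticAt ℂ U z := fun z hz ↦
    analyticAt_const.mul (analyticAt_eichlerIntegral_comp_ofComplex f hz)
  have hGdiff : DifferentiableOn ℂ Gc Hset := UpperHalfPlane.mdifferentiable_iff.mp G₁.holo'
  have hGan : AnalyticOnNhd ℂ Gc Hset := hGdiff.analyticOnNhd isOpen_upperHalfPlaneSet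
  have hΦdiff : DifferentiableOn ℂ ((⇑Φ₁) ∘ ofComplex) Hset := UpperHalfPlane.mdifferentiable_iff.mp Φ₁.holo'
  have hΦan : AnalyticOnNhd ℂ ((⇑Φ₁) ∘ ofComplex) Hset := hΦdiff.analyticOnNhd isOpen_upperHalfPlaneSet
  have hΨan : AnalyticOnNhd ℂ Ψc Hset := fun z hz ↦
    ((hΦan z hz).sub (analyticAt_const.mul (hGan z hz))).mul (hGan z hz)
  have hXan : ∀ z ∈ Hset, U z ∉ L₁.lattice → AnalyticAt ℂ X z := fun z hz hzL ↦ by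
    have hga : AnalyticAt ℂ g (U z) := (hg1 _ hzL).1
    exact AnalyticAt.comp_of_eq (g := g) (f := U) hga (hUan z hz) rfl
  -- `(X·Gc)² = Ψ` off the poles
  have hsq : ∀ z ∈ Hset, U z ∉ L₁.lattice → (X z * Gc z) ^ 2 = Ψc z := by
    intro z hz hzL
    have h1 := (hg1 _ hzL).2
    have h2 := hΦ (ofComplex z) hzL
    simp only [hX, hGc, hΨc, comp_apply]
    rw [mul_pow, h1, h2]
    linear_combination (-(G₁ (ofComplex z) ^ 2)) * hwp
  -- `X·Gc` is meromorphic on the half-plane with non-negative orders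
  have hXG : ∀ z ∈ Hset, MeromorphicAt (X * Gc) z ∧ 0 ≤ meromorphicOrderAt (X * Gc) z := by
    intro z hz
    by_cases hzL : U z ∈ L₁.lattice
    · refine meromorphicAt_of_sq_eq (hΨan z hz) ?_
      have hiso := eventually_mul_eichlerIntegral_notMem f hf L₁ hc₁' hz
      have hop : ∀ᶠ w in 𝓝[≠] z, 0 < w.im :=
        mem_nhdsWithin_of_mem_nhds (isOpen_upperHalfPlaneSet.mem_nhds hz)
      filter_upwards [hiso, hop] with w hw1 hw2
      exact ⟨((hXan w hw2 hw1).mul (hGan w hw2)).differentiableAt, hsq w hw2 hw1⟩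
    · have han : AnalyticAt ℂ (X * Gc) z := (hXan z hz hzL).mul (hGan z hz)
      exact ⟨han.meromorphicAt, han.meromorphicOrderAt_nonneg⟩
  have hXGm : MeromorphicOn (X * Gc) Hset := fun z hz ↦ (hXG z hz).1
  -- the normal form
  set Hc : ℂ → ℂ := toMeromorphicNFOn (X * Gc) Hset with hHc
  have hHan : AnalyticOnNhd ℂ Hc Hset := fun z hz ↦ analyticAt_toMeromorphicNFOn hXGm hz (hXG z hz).2
  have hHeq : ∀ z ∈ Hset, U z ∉ L₁.lattice → Hc z = X z * Gc z := fun z hz hzL ↦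
    toMeromorphicNFOn_apply_of_analyticAt hXGm hz ((hXan z hz hzL).mul (hGan z hz))
  -- identity-theorem set-up: a regular base point and the open regular locus
  have hconn : IsPreconnected Hset := convex_setOf_im_pos.isPreconnected
  obtain ⟨z₀, hz₀⟩ := nonempty_diff_of_countable (countable_setOf_eichlerIntegral_mem_lattice f L'' hf)
  have hz₀H : z₀ ∈ Hset := hz₀.1
  have hz₀L : U z₀ ∉ L₁.lattice := fun h ↦ hz₀.2 ⟨hz₀.1, (hmemL'' z₀).mp h⟩
  have hopen : IsOpen {z : ℂ | 0 < z.im ∧ U z ∉ L₁.lattice} := by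
    have hEq : {z : ℂ | 0 < z.im ∧ U z ∉ L₁.lattice} =
        {z : ℂ | 0 < z.im ∧ eichlerIntegral f (ofComplex z) ∉ L''.lattice} := by
      ext z; simp only [Set.mem_setOf_eq, hmemL'' z]
    rw [hEq]
    exact isOpen_setOf_eichlerIntegral_notMem_lattice f L''
  -- `Hc² = Ψ` on the half-plane
  have hHsq : ∀ z ∈ Hset, Hc z ^ 2 = Ψc z := by
    have hA : AnalyticOnNhd ℂ (fun z ↦ Hc z ^ 2) Hset := fun z hz ↦ (hHan z hz).pow 2
    have hev : (fun z ↦ Hc z ^ 2) =ᶠ[𝓝 z₀] Ψc := by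
      filter_upwards [hopen.mem_nhds ⟨hz₀H, hz₀L⟩] with z hz
      rw [hHeq z hz.1 hz.2, hsq z hz.1 hz.2]
    exact hA.eqOn_of_preconnected_of_eventuallyEq hΨan hconn hz₀H hev
  -- the transformation law on the half-plane
  have hinv : ∀ (γ : SL(2, ℤ)) (hγ : γ ∈ Gamma1 N) (ε : ℂ),
      (∀ w : ℂ, w ∉ L₁.lattice → g (w + (c₁ : ℂ) * cuspSymbol f ⟨γ, Gamma1_in_Gamma0 N hγ⟩) = ε * g w) →
      ∀ z ∈ Hset, Hc (moebius γ z) = ε * (((γ 1 0 : ℤ) * z + (γ 1 1 : ℤ)) ^ k * Hc z) := by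
    intro γ hγ ε hε
    set ℓ : ℂ := (c₁ : ℂ) * cuspSymbol f ⟨γ, Gamma1_in_Gamma0 N hγ⟩ with hℓ
    have hℓL : ℓ ∈ L₁.lattice := hin _ (cuspSymbol_mem_periodLatticeGamma1 f ⟨γ, hγ⟩)
    -- `U(γz) = U(z) + ℓ`
    have hUγ : ∀ z ∈ Hset, U (moebius γ z) = U z + ℓ := by
      intro z hz
      simp only [hU, hℓ]
      rw [← smul_ofComplex γ hz]
      have := eichlerIntegral_smul_sub_holds f ⟨γ, Gamma1_in_Gamma0 N hγ⟩ (ofComplex z)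
      rw [Subgroup.coe_mk] at this
      linear_combination (c₁ : ℂ) * this
    -- both sides are analytic on the half-plane
    have hA : AnalyticOnNhd ℂ (Hc ∘ moebius γ) Hset := fun z hz ↦
      (hHan (moebius γ z) (moebius_im_pos γ hz)).comp (analyticAt_moebius γ hz)
    have hB : AnalyticOnNhd ℂ (fun z ↦ ε * (((γ 1 0 : ℤ) * z + (γ 1 1 : ℤ)) ^ k * Hc z)) Hset := by
      intro z hz
      have hlin : AnalyticAt ℂ (fun z : ℂ ↦ ((γ 1 0 : ℤ) : ℂ) * z + (γ 1 1 : ℤ)) z :=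
        (analyticAt_const.mul analyticAt_id).add analyticAt_const
      have hpow : AnalyticAt ℂ (fun z : ℂ ↦ (((γ 1 0 : ℤ) : ℂ) * z + (γ 1 1 : ℤ)) ^ k) z :=
        hlin.zpow (moebius_denom_ne_zero γ hz)
      exact analyticAt_const.mul (hpow.mul (hHan z hz))
    -- they agree off the poles
    have hagree : ∀ z ∈ Hset, U z ∉ L₁.lattice →
        (Hc ∘ moebius γ) z = ε * (((γ 1 0 : ℤ) * z + (γ 1 1 : ℤ)) ^ k * Hc z) := by
      intro z hz hzL
      have hz' : moebius γ z ∈ Hset := moebius_im_pos γ hz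
      have hzL' : U (moebius γ z) ∉ L₁.lattice := by
        rw [hUγ z hz]
        exact fun h ↦ hzL (by simpa using sub_mem h hℓL)
      rw [comp_apply, hHeq _ hz' hzL', hHeq z hz hzL]
      have hXeq : X (moebius γ z) = ε * X z := by
        simp only [hX]
        rw [hUγ z hz]
        exact hε (U z) hzL
      have hGeq : Gc (moebius γ z) = ((γ 1 0 : ℤ) * z + (γ 1 1 : ℤ)) ^ k * Gc z := by
        simp only [hGc, comp_apply]
        rw [← smul_ofComplex γ hz, SlashInvariantForm.slash_action_eqn_SL'' G₁ hγ (ofComplex z),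
          denom_ofComplex γ hz]
      rw [hXeq, hGeq]
      ring
    have hev : (Hc ∘ moebius γ) =ᶠ[𝓝 z₀] fun z ↦ ε * (((γ 1 0 : ℤ) * z + (γ 1 1 : ℤ)) ^ k * Hc z) := by
      filter_upwards [hopen.mem_nhds ⟨hz₀H, hz₀L⟩] with z hz
      exact hagree z hz.1 hz.2
    have heq := hA.eqOn_of_preconnected_of_eventuallyEq hB hconn hz₀H hev
    intro z hz
    exact heq hz
  -- the function on `ℍ`
  refine ⟨fun τ : ℍ ↦ Hc τ, ?_, ?_, ?_, ?_⟩
  · rw [UpperHalfPlane.mdifferentiable_iff]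
    refine hHan.differentiableOn.congr fun z hz ↦ ?_
    simp only [comp_apply, ofComplex_apply_of_im_pos hz, UpperHalfPlane.coe_mk]
  · intro τ hτ
    have hτL : U τ ∉ L₁.lattice := by simpa [hU, ofComplex_apply] using hτ
    have := hHeq τ τ.im_pos hτL
    simpa [hX, hGc, hU, ofComplex_apply] using this
  · intro τ
    have := hHsq τ τ.im_pos
    simpa [hΨc, ofComplex_apply] using this
  · intro γ hγ ε hε
    funext τ
    have hd : denom γ τ = (γ 1 0 : ℤ) * (τ : ℂ) + (γ 1 1 : ℤ) := by
      rw [← denom_ofComplex γ τ.im_pos, ofComplex_apply]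
    have hd0 : denom γ τ ≠ 0 := denom_ne_zero γ τ
    have h1 : ((γ • τ : ℍ) : ℂ) = moebius γ τ := by
      rw [← coe_smul_ofComplex γ τ.im_pos, ofComplex_apply]
    rw [ModularForm.SL_slash_apply, Pi.smul_apply, smul_eq_mul]
    show Hc ((γ • τ : ℍ) : ℂ) * denom γ τ ^ (-k) = ε * Hc τ
    rw [h1, hinv γ hγ ε hε τ τ.im_pos, ← hd, zpow_neg, mul_assoc, mul_assoc, mul_comm (denom γ τ ^ k),
      mul_assoc, inv_mul_cancel₀ (zpow_ne_zero _ hd0), mul_one]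

end Summit.BirchSwinnertonDyer.BirchSwinnertonDyer.Theorems.DepletionAtTwo.KummerForm

end
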